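import Literature.NumberTheory.LFunctions.TaoLogChowlaMoebius
import Literature.NumberTheory.LFunctions.LiouvilleNonpretentious
import HarnessLib

/-!
# `μ` satisfies hypothesis (1.6) of Tao's Theorem 1.3 — unconditional discharge

Topic `Literature/NumberTheory/LFunctions`; sibling proof file of `TaoLogChowlaMoebius.lean`. NO named
facts: everything in this file is PROVED.

`Literature.NumberTheory.LFunctions.Tao2016_moebiusNonpretentious` (`TaoLogChowlaMoebius.lean`) is hypothesis (1.6) of Tao's
Theorem 1.3 (Forum Math. Pi 4 (2016) e8; arXiv:1509.05422) for `g₁ = μ` at every level `A`: for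
all sufficiently large `x`, `𝔻(μ, χ(n)n^{it}; x)² ≥ A` for all moduli `1 ≤ q ≤ A`, all Dirichlet
characters `χ` mod `q` and all `|t| ≤ A x`.  Tao (§1, paragraph after Remark 1.6) uses it when he
applies Corollary 1.5 "when `g₁, g₂` are multiplicative functions bounded by `1`, and at least one
of `g₁, g₂` is equal to the Möbius function `μ`", and (same paragraph) obtains the hypothesis for the
Liouville function from "the Vinogradov–Korobov error term zero-free region for `L`-functions".

Since the Granville–Soundararajan distance only involves values at primes and `μ(p) = λ(p) = -1`,
the statement for `μ` is the statement for `λ` (`Literature.NumberTheory.LFunctions.Tao2016_moebiusNonpretentious_iff`,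
proved in `TaoLogChowlaMoebius.lean`), and the `λ` statement is the theorem
`Literature.NumberTheory.LFunctions.Tao2016_liouvilleNonpretentious_holds` of `LiouvilleNonpretentious.lean` (proved there from
van der Corput's `ζ(σ + iu) = o(log |u|)`, `1 < σ ≤ 2`, the `k`-trick, Mertens' `3-4-1` inequality
and the non-vanishing of `L(s, χ)` on `Re s ≥ 1` from Mathlib — in place of the Vinogradov–Korobov
region the paper points to).  This file records the resulting discharge

* `Literature.NumberTheory.LFunctions.Tao2016_moebiusNonpretentious_holds : Tao2016_moebiusNonpretentious`

and its pointwise form `Literature.NumberTheory.LFunctions.moebius_pretentiousDistSq_eventually_ge`.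

## References
* T. Tao, *The logarithmically averaged Chowla and Elliott conjectures for two-point
  correlations*, Forum Math. Pi 4 (2016), e8; arXiv:1509.05422. Theorem 1.3 (hypothesis (1.6)),
  Corollary 1.5 (hypothesis (1.8)) and §1, paragraph following Remark 1.6.
-/

open Filter

namespace Literature.NumberTheory.LFunctions

/-- **DISCHARGE of `Literature.NumberTheory.LFunctions.Tao2016_moebiusNonpretentious`: `μ` satisfies hypothesis (1.6) of Tao's
Theorem 1.3 at every level `A`, unconditionally.** Tao (2016, §1, paragraph after Remark 1.6)
applies Corollary 1.5 "when `g₁, g₂` are multiplicative functions bounded by `1`, and at least one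
of `g₁, g₂` is equal to the Möbius function `μ`", i.e. with `μ` as the non-pretentious function, and
(same paragraph) obtains the hypothesis for the Liouville function from "the Vinogradov–Korobov
error term zero-free region for `L`-functions". Since hypothesis (1.6) only involves the values
`g₁(p)` at primes and `μ(p) = λ(p) = -1`, the statement for `μ` *is* the statement for `λ`
(`Tao2016_moebiusNonpretentious_iff`), and the latter is the theorem
`Literature.NumberTheory.LFunctions.Tao2016_liouvilleNonpretentious_holds` (`LiouvilleNonpretentious.lean`).
[cite: TaoFMP2016, §1, paragraph after Remark 1.6 (hypothesis (1.6)/(1.8) for μ, via the λ case)] -/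
theorem Tao2016_moebiusNonpretentious_holds : Tao2016_moebiusNonpretentious :=
  Tao2016_moebiusNonpretentious_iff.2 Tao2016_liouvilleNonpretentious_holds

/-- Pointwise form of the discharge: for every level `A`, for all sufficiently large `x`,
`𝔻(μ, χ(n)n^{it}; x)² ≥ A` whenever `1 ≤ q ≤ A`, `χ` is a Dirichlet character mod `q` and
`|t| ≤ A x`. [cite: TaoFMP2016, §1, paragraph after Remark 1.6 (hypothesis (1.6)/(1.8) for μ, via the λ case)] -/
theorem moebius_pretentiousDistSq_eventually_ge (A : ℝ) :
    ∀ᶠ x : ℝ in atTop, ∀ (q : ℕ) (χ : DirichletCharacter ℂ q) (t : ℝ), 1 ≤ q → (q : ℝ) ≤ A →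
      |t| ≤ A * x →
        A ≤ Sieve.pretentiousDistSq (ArithmeticFunction.moebius : ArithmeticFunction ℂ)
          (Sieve.twistedChar χ t) x :=
  Tao2016_moebiusNonpretentious_holds A

/-- **Theorem 1.3 ⇒ the Möbius two-point log-Chowla estimate, with the `μ`-hypothesis discharged**:
`Literature.NumberTheory.Sieve.tao_log_chowla_moebius` (`∑_{n ≤ x} μ(n)μ(n+h)/n = o(log x)`, `h ≥ 1`) follows from Tao's
Theorem 1.3 (`tao_log_averaged_elliott_two`) alone, through the `μ`-phrased reduction
`tao_log_chowla_moebius_of_elliott'` fed with `Tao2016_moebiusNonpretentious_holds`.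
[cite: TaoFMP2016, §1, paragraph after Remark 1.6; Theorem 1.3] -/
theorem tao_log_chowla_moebius_of_elliott_moebiusHyp (hE : tao_log_averaged_elliott_two) :
    Sieve.tao_log_chowla_moebius :=
  tao_log_chowla_moebius_of_elliott' hE Tao2016_moebiusNonpretentious_holds

end Literature.NumberTheory.LFunctions
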